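import Summits.NavierStokesRegularity.NavierStokesRegularity.Theorems.SoloRefuteLucardoOlivaes2026
import HarnessLib

/-!
# Solo salvage for claim C137 `LucardoOlivaes2026` (cell `ns-claims`, D-0090): Step 3 (the datum class is
# inhabited) in the kernel, and the literal-(7) composition with Step 3 discharged

Claim C137: skeleton `Literature.Claims.NS.LucardoOlivaes2026` (typist-10 g4, p509525 + rev 2–4). Its §3
step `Step3_Datum` («we define u₀(x) as an interacting Ouroboros vortex knot …», p.2 l.12–26, typed at the
grain of its printed ANALYTIC content: a smooth divergence-free field with every derivative in `L²`, compactly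
supported non-zero vorticity EXISTS) is TRUE, and the refuter's kill file
(`Theorems/SoloRefuteLucardoOlivaes2026.lean`, refuter-2 g4, p513605) already carries an explicit member of the
class, the swirling bump `u0 = ψ(|x|²)·(−x₁, x₀, 0)` with `isOuroDatum_u0 : IsOuroDatum u0`. This file records

* `step3_Datum_holds : Step3_Datum` — one line from `isOuroDatum_u0`;
* `claim_of_literal7 : Step8_DiffIneq7 → Step7_DissipRate → Step9_Reduction8 → Step10_Divergence →
  ClaimedTheorem` — the skeleton's `claim_of_steps_literal7` with its Step-3 premise discharged, so that on the
  literal-(7) path only the paper's analytic steps remain as hypotheses;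
* `exists_isLocalSolution_u0` — the explicit datum launches a regular local solution at every `ν ≥ 0`
  (`exists_isLocalSolution`, Majda–Bertozzi Thm. 3.4, PROVED in the tree): the objects the solution-grain
  steps quantify over exist for this datum.

Salvage seat `ns-claims-salvage-p4` g3 (solo lane; no statement item). Nothing disputed is asserted: the
located step of record is `Step6GI_StretchLower` (class unfilled gap, chair 2026-08-27T08:08:56Z) and the
false faces are the refuter's (`not_Step6_StretchLower`, `not_Step6F_StretchLower_fun`,
`not_Step7F_DissipRate_fun`); the compositions `claim_of_steps` / `claim_of_stepsG` through the REFUTED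
solution-grain (6) are deliberately not re-exported with Step 3 discharged (they would be vacuous).

WHAT THIS IS NOT: not a claim about NS regularity or blow-up; not a claim about any author beyond the typed
locator.
-/

-- The summit's canonical theorem namespace repeats the summit name (single-conjunct summit).
set_option linter.dupNamespace false

noncomputable section

namespace Summit.NavierStokesRegularity.NavierStokesRegularity.Theorems.LucardoOlivaes2026

open Literature.Claims.NS.Chae2007 (IsLocalSolution)
open Literature.Claims.NS.LucardoOlivaes2026

/-- **C137 Step 3 holds — the Ouroboros datum class (printed analytic content of §3 p.2 l.12–26) is
inhabited**, by the explicit swirling bump `u0` of the kill file. [cite: LucardoOlivaes2026, §3 p.2 l.12–26] -/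
theorem step3_Datum_holds : Step3_Datum :=
  ⟨u0, isOuroDatum_u0⟩

/-- **The explicit datum launches a regular local solution at every viscosity `ν ≥ 0`** (Majda–Bertozzi
Thm. 3.4 via `exists_isLocalSolution`): the solution-grain steps (5)–(8) are not vacuous on it.
[cite: MajdaBertozzi2002, Thm. 3.4 (i)-(ii) p. 104] -/
theorem exists_isLocalSolution_u0 {ν : ℝ} (hν : 0 ≤ ν) :
    ∃ T : ℝ, 0 < T ∧ ∃ (u : ℝ → E3 → E3) (p : ℝ → E3 → ℝ), IsLocalSolution ν T u0 u p :=
  exists_isLocalSolution hν isOuroDatum_u0.1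

/-- **The literal-(7) composition with Step 3 discharged**: the printed differential inequality (7), the §5
rate sentence, the §6 reduction to (8) and the divergence step give the claimed statement — the skeleton's
`claim_of_steps_literal7` fed with `step3_Datum_holds`. [cite: LucardoOlivaes2026, (7) p.2, §§5–6 pp.2–3] -/
theorem claim_of_literal7 (h8 : Step8_DiffIneq7) (h7 : Step7_DissipRate) (h9 : Step9_Reduction8)
    (h10 : Step10_Divergence) : ClaimedTheorem :=
  claim_of_steps_literal7 step3_Datum_holds h8 h7 h9 h10

end Summit.NavierStokesRegularity.NavierStokesRegularity.Theorems.LucardoOlivaes2026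

end
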